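import Mathlib
import Summits.CriticalPhenomena.PercolationContinuityZ3.Theorems.PercNearOneGluingAdditiveGluingGoodStepCorner
import HarnessLib

/-! # Crux `PercNearOneGluing.AdditiveGluing` (stmt-CriticalPhenomena-4576), line `subuniform-dead-pocket-maximum` — the singleton glued corner and Kozma–Nitzan Theorem 5 via the corner reduction (siege k4)

Helper file for the crux (skeleton `Cruxes/AdditiveGluing/Lines/subuniform-dead-pocket-maximum.lean`,
stub `stub_goodStep`); lands with `--supports stmt-CriticalPhenomena-4576`.

1. `goodStep_corner_singleton` — the corner inequality of `goodStep_corner` for a SINGLETON low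
   layer `{x}` follows from goodness of `(w⁰, A, x, b)` (the induction hypothesis; `q_{{x}} = w⁰`),
   re-indexing the pockets `W' ∋ x` of `x` in `H` as the pockets `insert o W'` of `o`
   (`{C(x) = W'} ⊆ E_{{x}}(insert o W')`; pockets `W' ∋ o` of `x` are `μ_{w⁰}`-null; currency
   comparison `μ_{w⁰}(z ↔ b in W'ᶜ) ≤ μ_w(z ↔ b in (insert o W')ᶜ)`).
2. `stub_goodStepOneLowViaCorner_k4` — **Kozma–Nitzan Theorem 5** (arXiv:2401.12397 pp. 13–14) for an
   observer with arbitrary relay neighbours and AT MOST ONE low neighbour of positive weight: the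
   conclusion of `stub_goodStep` under that extra hypothesis, obtained as `goodStep_corner` + 1 +
   the induction hypothesis at `w⁰` (`o` drops out of the positive-degree vertices).  The same
   statement (with the unique low neighbour named) was landed independently by siege k20 as
   `stub_goodStepUniqueLow`; here it certifies that the corner reduction consumes the induction
   hypothesis as intended.
-/

namespace Summit.CriticalPhenomena.PercolationContinuityZ3.Theorems

open MeasureTheory Set
open Literature.Probability.LatticeModels (prodBernoulli)
open Literature.Probability.Percolation (BondConfig openConn openConnIn openGraph openCluster
  openGraph_adj DeterminedBy determinedBy_iff)
open scoped BigOperators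

noncomputable section
open Classical

variable {n : ℕ}

/-! ### The currency of a pocket of `x` in `H` versus the pocket `insert o ·` of `o` in `G` -/

/-- A path inside `T` that never steps ONTO `o` stays inside `T ∖ {o}` (if it starts off `o`).
[folklore] -/
theorem goodStepCorner_pathIn_avoid {V : Type*} {G : SimpleGraph V} {T : Set V} {o x b : V}
    (hx : x ≠ o) (hstep : ∀ p q, G.Adj p q → q ≠ o)
    (h : Literature.Probability.Percolation.PathIn G T x b) :
    Literature.Probability.Percolation.PathIn G (T ∩ {q | q ≠ o}) x b := by
  obtain ⟨hxT, hr⟩ := h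
  refine ⟨⟨hxT, hx⟩, ?_⟩
  induction hr with
  | refl => exact Relation.ReflTransGen.refl
  | tail _ hbc ih => exact ih.tail ⟨hbc.1, hbc.2, hstep _ _ hbc.1⟩

/-- **Currency comparison.**  For `z ≠ o`:
`μ_{w⁰}(z ↔ b in W'ᶜ) ≤ μ_w(z ↔ b in (insert o W')ᶜ)` — under `w⁰` the star of `o` is a.s.
closed, so an open path inside `W'ᶜ` a.s. avoids `o`, and the event `{z ↔ b in (insert o W')ᶜ}`
is determined by pairs on which `w⁰ = w`. [folklore] -/
theorem goodStepCorner_currency_le (w : Sym2 (Fin n) → unitInterval) (o z b : Fin n)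
    (W' : Finset (Fin n)) (hz : z ≠ o) :
    (prodBernoulli (fun e : Sym2 (Fin n) =>
        if (∃ x ∈ e, x ∈ ({o} : Finset (Fin n))) then (0 : unitInterval) else w e)).real
        (openConnIn ((W' : Set (Fin n))ᶜ) z b) ≤
      (prodBernoulli w).real (openConnIn ((insert o W' : Finset (Fin n)) : Set (Fin n))ᶜ z b) := by
  set p : Sym2 (Fin n) → unitInterval :=
    fun e => if (∃ x ∈ e, x ∈ ({o} : Finset (Fin n))) then (0 : unitInterval) else w e with hp
  -- (1) inclusion up to the null event "some pair at `o` is open"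
  have hsub : (openConnIn ((W' : Set (Fin n))ᶜ) z b : Set (BondConfig (Fin n))) ⊆
      openConnIn (((insert o W' : Finset (Fin n)) : Set (Fin n))ᶜ) z b ∪
        {ω | ∃ y : Fin n, y ≠ o ∧ s(o, y) ∈ ω} := by
    intro ω hω
    by_cases hN : ∃ y : Fin n, y ≠ o ∧ s(o, y) ∈ ω
    · exact Or.inr hN
    · left
      push Not at hN
      have hpath := Literature.Probability.Percolation.DCT16.pathIn_of_mem_openConnIn hω
      have hstep : ∀ p q, (openGraph ω).Adj p q → q ≠ o := by
        intro p q hpq hq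
        rw [openGraph_adj, hq, Sym2.eq_swap] at hpq
        exact hN p hpq.2 hpq.1
      have h2 := goodStepCorner_pathIn_avoid hz hstep hpath
      refine Literature.Probability.Percolation.DCT16.mem_openConnIn_of_pathIn ?_
      have hset : ((W' : Set (Fin n))ᶜ ∩ {q : Fin n | q ≠ o}) =
          (((insert o W' : Finset (Fin n)) : Set (Fin n))ᶜ) := by
        ext q
        simp only [Set.mem_inter_iff, Set.mem_compl_iff, Finset.mem_coe, Set.mem_setOf_eq,
          Finset.mem_insert, not_or]
        tauto
      rw [hset] at h2
      exact h2
  have hnull : (prodBernoulli p).real {ω : BondConfig (Fin n) | ∃ y : Fin n, y ≠ o ∧ s(o, y) ∈ ω}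
      = 0 := goodStepCorner_kill_null w o _ fun ω hω => hω
  -- (2) on pairs avoiding `o` the weights agree
  have heq : (prodBernoulli p).real
      (openConnIn (((insert o W' : Finset (Fin n)) : Set (Fin n))ᶜ) z b) =
      (prodBernoulli w).real (openConnIn (((insert o W' : Finset (Fin n)) : Set (Fin n))ᶜ) z b) := by
    refine Literature.Probability.LatticeModels.prodBernoulli_real_eq_of_determinedBy p w
      (F := (((insert o W' : Finset (Fin n)) : Set (Fin n))ᶜ).sym2) (fun e he => ?_)
      (Literature.Probability.Percolation.DCT16.determinedBy_openConnIn _ z b subset_rfl)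
      MeasurableSet.of_discrete
    refine goodStepCorner_kill_of_notMem w o e fun hoe => ?_
    have := Set.mem_sym2_iff_subset.1 he hoe
    simp at this
  calc (prodBernoulli p).real (openConnIn ((W' : Set (Fin n))ᶜ) z b)
      ≤ (prodBernoulli p).real (openConnIn (((insert o W' : Finset (Fin n)) : Set (Fin n))ᶜ) z b ∪
          {ω | ∃ y : Fin n, y ≠ o ∧ s(o, y) ∈ ω}) := measureReal_mono hsub
    _ ≤ (prodBernoulli p).real (openConnIn (((insert o W' : Finset (Fin n)) : Set (Fin n))ᶜ) z b) +
          (prodBernoulli p).real {ω : BondConfig (Fin n) | ∃ y : Fin n, y ≠ o ∧ s(o, y) ∈ ω} :=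
        measureReal_union_le _ _
    _ = (prodBernoulli w).real
          (openConnIn (((insert o W' : Finset (Fin n)) : Set (Fin n))ᶜ) z b) := by
        rw [hnull, add_zero, heq]

/-! ### The induction measure drops when the star of `o` is killed -/

/-- Killing the star of an observer with a positive-weight non-loop pair strictly decreases the
number of positive-degree vertices. [folklore] -/
theorem goodStepCorner_posdeg_kill_lt (w : Sym2 (Fin n) → unitInterval) (o y : Fin n)
    (hwy : (w s(o, y) : ℝ) ≠ 0) :
    (Finset.univ.filter (fun v : Fin n => ∃ u : Fin n,
        0 < ((fun e : Sym2 (Fin n) =>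
          if (∃ x ∈ e, x ∈ ({o} : Finset (Fin n))) then (0 : unitInterval) else w e) s(u, v) : ℝ))).card
      < (Finset.univ.filter (fun v : Fin n => ∃ u : Fin n, 0 < (w s(u, v) : ℝ))).card := by
  refine Finset.card_lt_card ((Finset.ssubset_iff_of_subset ?_).2 ⟨o, ?_, ?_⟩)
  · intro v hv
    simp only [Finset.mem_filter, Finset.mem_univ, true_and] at hv ⊢
    obtain ⟨u, hu⟩ := hv
    refine ⟨u, ?_⟩
    by_cases h : ∃ x ∈ s(u, v), x ∈ ({o} : Finset (Fin n))
    · rw [if_pos h] at hu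
      exact absurd hu (lt_irrefl _)
    · rwa [if_neg h] at hu
  · simp only [Finset.mem_filter, Finset.mem_univ, true_and]
    refine ⟨y, ?_⟩
    rw [Sym2.eq_swap]
    exact lt_of_le_of_ne (unitInterval.nonneg _) (Ne.symm hwy)
  · simp only [Finset.mem_filter, Finset.mem_univ, true_and, not_exists, not_lt]
    intro u
    rw [if_pos ⟨o, Sym2.mem_mk_right u o, Finset.mem_singleton_self o⟩]
    exact le_rfl


/-! ### A singleton low layer: the corner inequality from goodness of `(w⁰, A, x, b)` -/

/-- **The corner inequality for a singleton low layer `{x}`** follows from goodness of the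
quadruple `(w⁰, A, x, b)` (the graph with the star of `o` killed, observer `x`; `q_{{x}} = w⁰`),
applied at the level `1 − μ_{w⁰}(a₀ ↔ b)` with the selection `W' ↦ sel (insert o W')`: its KN form
`μ_{w⁰}(a₀↔b) ≤ μ_{w⁰}(x↔b) + Σ_{W' ∋ x} μ_{w⁰}(C(x)=W')·μ_{w⁰}(sel(insert o W') ↔ b in W'ᶜ)` is
bounded by the corner right-hand side through the re-indexing `W' ↦ insert o W'`
(`{C(x) = W'} ⊆ E_{{x}}(insert o W')`, pockets `W' ∋ o` of `x` are `μ_{w⁰}`-null, and the currency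
comparison `goodStepCorner_currency_le`). (Kozma–Nitzan arXiv:2401.12397, proof of Thm 5 p. 14.) -/
theorem goodStep_corner_singleton (w : Sym2 (Fin n) → unitInterval) (A : Finset (Fin n))
    (o b a₀ x : Fin n) (sel : Finset (Fin n) → Fin n) (hbA : b ∈ A) (hoA : o ∉ A)
    (hxo : x ≠ o) (hsel : ∀ W, sel W ∈ A)
    (hgood : (prodBernoulli (fun e : Sym2 (Fin n) =>
          if (∃ x ∈ e, x ∈ ({o} : Finset (Fin n))) then (0 : unitInterval) else w e)).real
          ((⋃ a ∈ A, openConn x a) ∩ (openConn x b)ᶜ)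
        + ∑ W' ∈ (Finset.univ : Finset (Finset (Fin n))).filter (fun W' => x ∈ W' ∧ Disjoint W' A),
          (prodBernoulli (fun e : Sym2 (Fin n) =>
              if (∃ x ∈ e, x ∈ ({o} : Finset (Fin n))) then (0 : unitInterval) else w e)).real
              {ω : BondConfig (Fin n) | openCluster ω x = (W' : Set (Fin n))}
            * (prodBernoulli (fun e : Sym2 (Fin n) =>
              if (∃ x ∈ e, x ∈ ({o} : Finset (Fin n))) then (0 : unitInterval) else w e)).real
              (openConnIn ((W' : Set (Fin n))ᶜ) (sel (insert o W')) b)ᶜ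
        ≤ 1 - (prodBernoulli (fun e : Sym2 (Fin n) =>
          if (∃ x ∈ e, x ∈ ({o} : Finset (Fin n))) then (0 : unitInterval) else w e)).real
          (openConn a₀ b)) :
    (prodBernoulli (fun e : Sym2 (Fin n) =>
        if (∀ y ∈ e, y ∈ ({x} : Finset (Fin n))) ∧ ¬ e.IsDiag then (1 : unitInterval) else
          if (∃ x ∈ e, x ∈ ({o} : Finset (Fin n))) then 0 else w e)).real (openConn a₀ b) ≤
      (prodBernoulli (fun e : Sym2 (Fin n) =>
          if (∀ y ∈ e, y ∈ ({x} : Finset (Fin n))) ∧ ¬ e.IsDiag then (1 : unitInterval) else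
            if (∃ x ∈ e, x ∈ ({o} : Finset (Fin n))) then 0 else w e)).real
          (⋃ s ∈ ({x} : Finset (Fin n)), openConn s b) +
        ∑ W ∈ (Finset.univ : Finset (Finset (Fin n))).filter (fun W => o ∈ W ∧ Disjoint W A),
          (prodBernoulli (fun e : Sym2 (Fin n) =>
              if (∀ y ∈ e, y ∈ ({x} : Finset (Fin n))) ∧ ¬ e.IsDiag then (1 : unitInterval) else
                if (∃ x ∈ e, x ∈ ({o} : Finset (Fin n))) then 0 else w e)).real
              {ω' : BondConfig (Fin n) | ∀ y : Fin n, y ∈ W ↔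
                (y = o ∨ ∃ s ∈ ({x} : Finset (Fin n)), ω' ∈ openConn s y)} *
            (prodBernoulli w).real (openConnIn ((W : Set (Fin n))ᶜ) (sel W) b) := by
  have hq : (fun e : Sym2 (Fin n) =>
      if (∀ y ∈ e, y ∈ ({x} : Finset (Fin n))) ∧ ¬ e.IsDiag then (1 : unitInterval) else
        if (∃ x ∈ e, x ∈ ({o} : Finset (Fin n))) then 0 else w e) =
      (fun e : Sym2 (Fin n) =>
        if (∃ x ∈ e, x ∈ ({o} : Finset (Fin n))) then (0 : unitInterval) else w e) :=
    goodStepCorner_glue_subsingleton _ {x} (by simp)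
  rw [hq, Finset.set_biUnion_singleton]
  set p : Sym2 (Fin n) → unitInterval :=
    fun e => if (∃ x ∈ e, x ∈ ({o} : Finset (Fin n))) then (0 : unitInterval) else w e with hp
  set F : Finset (Finset (Fin n)) :=
    (Finset.univ : Finset (Finset (Fin n))).filter (fun W => o ∈ W ∧ Disjoint W A) with hF
  set F' : Finset (Finset (Fin n)) :=
    (Finset.univ : Finset (Finset (Fin n))).filter (fun W' => x ∈ W' ∧ Disjoint W' A) with hF'
  set c : Finset (Fin n) → ℝ :=
    fun W => (prodBernoulli w).real (openConnIn ((W : Set (Fin n))ᶜ) (sel W) b) with hc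
  set c' : Finset (Fin n) → ℝ :=
    fun W' => (prodBernoulli p).real (openConnIn ((W' : Set (Fin n))ᶜ) (sel (insert o W')) b)
    with hc'
  -- KN form at `x`
  have hcompl : ∀ W' : Finset (Fin n),
      (prodBernoulli p).real (openConnIn ((W' : Set (Fin n))ᶜ) (sel (insert o W')) b)ᶜ =
        1 - c' W' := fun W' => probReal_compl_eq_one_sub MeasurableSet.of_discrete
  rw [Finset.sum_congr rfl fun W' _ => by rw [hcompl W'],
    goodStepCorner_selection_identity p A x b hbA c'] at hgood
  have hKN : (prodBernoulli p).real (openConn a₀ b) ≤ (prodBernoulli p).real (openConn x b) +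
      ∑ W' ∈ F', (prodBernoulli p).real
        {ω : BondConfig (Fin n) | openCluster ω x = (W' : Set (Fin n))} * c' W' := by
    linarith
  refine hKN.trans (add_le_add le_rfl ?_)
  -- pockets `W' ∋ o` of `x` are null
  set F'' : Finset (Finset (Fin n)) := F'.filter (fun W' => o ∉ W') with hF''
  have hvan : ∀ W' ∈ F', W' ∉ F'' →
      (prodBernoulli p).real {ω : BondConfig (Fin n) | openCluster ω x = (W' : Set (Fin n))} *
        c' W' = 0 := by
    intro W' hW' hW''
    have hoW' : o ∈ W' := by
      by_contra h
      exact hW'' (Finset.mem_filter.2 ⟨hW', h⟩)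
    have h0 : (prodBernoulli p).real
        {ω : BondConfig (Fin n) | openCluster ω x = (W' : Set (Fin n))} = 0 := by
      refine goodStepCorner_kill_null w o _ fun ω hω => ?_
      have hω' : openCluster ω x = (W' : Set (Fin n)) := hω
      have hox : o ∈ openCluster ω x := by
        rw [hω']
        exact Finset.mem_coe.2 hoW'
      obtain ⟨z, hzo, hz, -⟩ := goodBase_exists_open_pair (SimpleGraph.Reachable.symm hox) hxo
      exact ⟨z, hzo, hz⟩
    rw [h0, zero_mul]
  rw [← Finset.sum_subset (Finset.filter_subset _ F') hvan]
  -- termwise comparison with the pocket `insert o W'` of `o`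
  have hterm : ∀ W' ∈ F'',
      (prodBernoulli p).real {ω : BondConfig (Fin n) | openCluster ω x = (W' : Set (Fin n))} *
          c' W' ≤
        (prodBernoulli p).real
            {ω' : BondConfig (Fin n) | ∀ y : Fin n, y ∈ insert o W' ↔
              (y = o ∨ ∃ s ∈ ({x} : Finset (Fin n)), ω' ∈ openConn s y)} *
          c (insert o W') := by
    intro W' _
    refine mul_le_mul ?_ ?_ measureReal_nonneg measureReal_nonneg
    · refine measureReal_mono (fun ω' hω' y => ?_) (measure_ne_top _ _)
      have hC : openCluster ω' x = (W' : Set (Fin n)) := hω'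
      rw [Finset.mem_insert]
      refine or_congr_right ?_
      rw [← Finset.mem_coe, ← hC]
      constructor
      · intro h
        exact ⟨x, Finset.mem_singleton_self x, h⟩
      · rintro ⟨s, hs, h⟩
        rw [Finset.mem_singleton] at hs
        rw [hs] at h
        exact h
    · exact goodStepCorner_currency_le w o (sel (insert o W')) b W'
        (fun h => hoA (h ▸ hsel (insert o W')))
  have hinj : ∀ W₁ ∈ F'', ∀ W₂ ∈ F'', insert o W₁ = insert o W₂ → W₁ = W₂ := by
    intro W₁ h₁ W₂ h₂ h
    rw [← Finset.erase_insert (Finset.mem_filter.1 h₁).2, h,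
      Finset.erase_insert (Finset.mem_filter.1 h₂).2]
  have himg : F''.image (insert o) ⊆ F := by
    intro W hW
    obtain ⟨W', hW', rfl⟩ := Finset.mem_image.1 hW
    have hW'F' := (Finset.mem_filter.1 (Finset.mem_filter.1 hW').1).2
    exact Finset.mem_filter.2 ⟨Finset.mem_univ _, Finset.mem_insert_self o W',
      Finset.disjoint_insert_left.2 ⟨hoA, hW'F'.2⟩⟩
  calc ∑ W' ∈ F'', (prodBernoulli p).real
          {ω : BondConfig (Fin n) | openCluster ω x = (W' : Set (Fin n))} * c' W'
      ≤ ∑ W' ∈ F'', (prodBernoulli p).real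
            {ω' : BondConfig (Fin n) | ∀ y : Fin n, y ∈ insert o W' ↔
              (y = o ∨ ∃ s ∈ ({x} : Finset (Fin n)), ω' ∈ openConn s y)} *
          c (insert o W') := Finset.sum_le_sum hterm
    _ = ∑ W ∈ F''.image (insert o), (prodBernoulli p).real
            {ω' : BondConfig (Fin n) | ∀ y : Fin n, y ∈ W ↔
              (y = o ∨ ∃ s ∈ ({x} : Finset (Fin n)), ω' ∈ openConn s y)} * c W :=
        (Finset.sum_image (f := fun W => (prodBernoulli p).real
            {ω' : BondConfig (Fin n) | ∀ y : Fin n, y ∈ W ↔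
              (y = o ∨ ∃ s ∈ ({x} : Finset (Fin n)), ω' ∈ openConn s y)} * c W) hinj).symm
    _ ≤ ∑ W ∈ F, (prodBernoulli p).real
            {ω' : BondConfig (Fin n) | ∀ y : Fin n, y ∈ W ↔
              (y = o ∨ ∃ s ∈ ({x} : Finset (Fin n)), ω' ∈ openConn s y)} * c W :=
        Finset.sum_le_sum_of_subset_of_nonneg himg fun W _ _ =>
          mul_nonneg measureReal_nonneg measureReal_nonneg

/-! ### Kozma–Nitzan Theorem 5: the step when the observer has at most one low neighbour -/

/-- **Kozma–Nitzan Theorem 5 (arXiv:2401.12397 §3.2, pp. 13–14), generalised: the inductive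
step `stub_goodStep` when the observer has AT MOST ONE low neighbour of positive weight.**
If `b ∈ A`, `o ∉ A`, `o` has a low neighbour of positive weight and all such neighbours coincide,
and every quadruple on a weight function with fewer positive-degree vertices is good, then
`(w, A, o, b)` is good (linear selection form of the line `subuniform-dead-pocket-maximum`).
Proof: `goodStep_corner` with `a₀` a minimiser of `μ_{w⁰}(· ↔ b)` over `A`; the only nonempty
positive low layer is the singleton `{y}`, whose corner inequality is
`goodStep_corner_singleton` fed with the induction hypothesis at `w⁰` (killing the star of `o`
removes `o` from the positive-degree vertices, `goodStepCorner_posdeg_kill_lt`).  KN state the case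
where, in addition, `o`'s other neighbours lie in `A` and `y`'s neighbours lie in `A ∪ {o}`; the
latter restriction is not needed. -/
theorem stub_goodStepOneLowViaCorner_k4 :
    ∀ (n : ℕ) (w : Sym2 (Fin n) → unitInterval) (A : Finset (Fin n)) (o b : Fin n),
      b ∈ A → o ∉ A →
      (∃ y : Fin n, y ∉ A ∧ y ≠ o ∧ (w s(o, y) : ℝ) ≠ 0) →
      (∀ y y' : Fin n, y ∉ A → y' ∉ A → y ≠ o → y' ≠ o →
        (w s(o, y) : ℝ) ≠ 0 → (w s(o, y') : ℝ) ≠ 0 → y = y') →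
      (∀ w' : Sym2 (Fin n) → unitInterval,
        (Finset.univ.filter (fun v : Fin n => ∃ u : Fin n, 0 < (w' s(u, v) : ℝ))).card
          < (Finset.univ.filter (fun v : Fin n => ∃ u : Fin n, 0 < (w s(u, v) : ℝ))).card →
        ∀ (A' : Finset (Fin n)) (o' b' : Fin n), b' ∈ A' → o' ∉ A' →
        ∀ (t : ℝ) (sel : Finset (Fin n) → Fin n), (∀ W, sel W ∈ A') →
          (∀ a ∈ A', 1 - t ≤ (prodBernoulli w').real (openConn a b')) →
          (prodBernoulli w').real ((⋃ a ∈ A', openConn o' a) ∩ (openConn o' b')ᶜ)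
            + ∑ W ∈ (Finset.univ : Finset (Finset (Fin n))).filter (fun W => o' ∈ W ∧ Disjoint W A'),
                (prodBernoulli w').real {ω : BondConfig (Fin n) | openCluster ω o' = (W : Set (Fin n))}
                  * (prodBernoulli w').real (openConnIn ((W : Set (Fin n))ᶜ) (sel W) b')ᶜ
            ≤ t) →
      ∀ (t : ℝ) (sel : Finset (Fin n) → Fin n), (∀ W, sel W ∈ A) →
        (∀ a ∈ A, 1 - t ≤ (prodBernoulli w).real (openConn a b)) →
        (prodBernoulli w).real ((⋃ a ∈ A, openConn o a) ∩ (openConn o b)ᶜ)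
          + ∑ W ∈ (Finset.univ : Finset (Finset (Fin n))).filter (fun W => o ∈ W ∧ Disjoint W A),
              (prodBernoulli w).real {ω : BondConfig (Fin n) | openCluster ω o = (W : Set (Fin n))}
                * (prodBernoulli w).real (openConnIn ((W : Set (Fin n))ᶜ) (sel W) b)ᶜ
          ≤ t := by
  intro n w A o b hbA hoA hlow huniq IH t sel hsel ht
  obtain ⟨y₀, hy₀A, hy₀o, hwy₀⟩ := hlow
  -- the worst relay off `o`
  obtain ⟨a₀, ha₀A, hmin⟩ := Finset.exists_min_image A
    (fun v => (prodBernoulli (fun e : Sym2 (Fin n) =>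
      if (∃ x ∈ e, x ∈ ({o} : Finset (Fin n))) then (0 : unitInterval) else w e)).real
      (openConn v b)) ⟨b, hbA⟩
  refine goodStep_corner w A o b a₀ sel hbA hoA ha₀A hsel hmin ?_ t ht
  intro S hS hne hdisj
  -- the only nonempty positive low layer is `{y₀}`
  have hmem : ∀ x ∈ S, x = y₀ := fun x hx =>
    huniq x y₀ (Finset.disjoint_left.1 hdisj hx) hy₀A (hS x hx).1 hy₀o
      (fun h => (hS x hx).2 (Set.Icc.coe_eq_zero.1 h)) hwy₀
  have hSy : S = {y₀} := by
    refine Finset.eq_singleton_iff_unique_mem.2 ⟨?_, hmem⟩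
    obtain ⟨x, hx⟩ := hne
    rw [← hmem x hx]
    exact hx
  subst hSy
  refine goodStep_corner_singleton w A o b a₀ y₀ sel hbA hoA hy₀o hsel ?_
  -- goodness of `(w⁰, A, y₀, b)` from the induction hypothesis
  refine IH _ (goodStepCorner_posdeg_kill_lt w o y₀ hwy₀) A y₀ b hbA hy₀A _ (fun W' => sel (insert o W'))
    (fun W' => hsel _) fun a ha => ?_
  have h := hmin a ha
  linarith


end

end Summit.CriticalPhenomena.PercolationContinuityZ3.Theorems
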